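import Summits.QuantumFields.BalabanUV.Beta.D1BFx.RoadEndBFxWiredMeanS
import Summits.QuantumFields.BalabanUV.Beta.D1BFx.RoadEndBFxD1SumS

/-!
# `BalabanUV.Beta.D1BFx.RoadEndBFxD1SumMeanS` — road «BF-x» for binder row D1, slot (K): **THE JUNCTION WITH THE ROW's SPINE ON THE MEAN LANE** — the
# mean-lane twin of the OWNER d1-p2-g13's «END-D1Tel-S» ∕ «END-D1Sum-S» (`RoadEndBFxD1TelS` p298379, `RoadEndBFxD1SumS` p298645): under the Literature's read-out-level
# telescoping binder `StepDriftWitness.D1Sum Lc Js Jc μ ν` (⟸ the spine's `D1Tel` + printed symmetries, `d1Sum_of_d1Tel`) bridge B1 IN CESÀRO FORM is, EXACTLY, the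
# CESÀRO one-shot (K)-estimate `(secondMoment (TshotOf Lc Jc m) μ ν − c (Lc^m)) ∕ m → 0`; the MEAN-lane «END-ii» END `RoadEndBFxWiredMeanS.d1Drift_BFx_mean_of_prop12S'`
# (p298064) OVER `D1Sum` + that estimate; and THE MEAN LANE SUPPLIES THE SPINE's `D1Rep`

HONEST DEPENDENCY (cell records, verbatim): «continuum YM on T⁴ ⇐ BetaPertH ∧ nine spine estimates (0/9 proved); BetaPertH ⇐ (D1) ∧ (D4) ∧
CAP+tail; G-an2-4 gates asym, D1 and NE2/3/4.»  HONEST FRAMING (cell contract, verbatim): «discharging `BetaPertH` makes Bałaban's UV stability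
UNCONDITIONAL — a real constructive-QFT result; it is NOT the continuum limit and NOT the Clay problem.»  THIS MODULE DISCHARGES NOTHING of the
wall: [folklore] composition BY NAME of the Literature's `StepDriftWitness.d1Sum_iff` ∕ `d1Sum_of_d1Tel` ∕ `d1Rep_iff_d1Drift_of_d1Sum` (an4∕the lead's read-out seam), `Filter.Tendsto.congr'`,
the owner's `RoadEndBFxD1SumS.window_id`, and this lineage's mean-lane END `RoadEndBFxWiredMeanS.d1Drift_BFx_mean_of_prop12S'`.  No `def`, no `def … : Prop`, nothing cited,
0 sorry.  Root-level binders of row D1 (referee's census: hW ∕ hR-sockets ∕ hSX-socket ∕ D1Tel ∕ D1Rep) — 0 discharged; (K) NOT closed; NOT D1, NOT `BetaPertH`, NOT continuum, NOT Clay.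

ABSOLUTE RULE (cell charter, verbatim): «No internally-minted statement may enter as a cited fact. Every hypothesis is either kernel-proved in
this package or a verbatim quotation of a PUBLISHED theorem with page reference. The manuscript(s) under audit are NOT citable for their own
disputed steps — they are the thing under adjudication; programme-internal (2001/route/tribunal) claims are never citable.»

WHY.  The owner's gen-13 junction files make the TOTAL-SHELL lane's bridge `hB1 : ∀ m ≥ 1, |Σ_{j<m} β⁰_j − c (Lc^m)| ≤ U₁` the telescoping binder (`D1Sum`, or the spine's
`D1Tel` + `hW`∕`hRfl`) + the uniform one-shot estimate `hKshot`, constant for constant, and supply the spine's `D1Rep` from the road's list (`d1Rep_BFx_of_D1Sum_shotKS`).  Under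
`D1Sum` the partial sums ARE the one-shot second moments for `m ≥ 1`, so the MEAN lane's Cesàro bridge `((Σ_{j<m} β⁰_j) − c (Lc^m)) ∕ m → 0` (the lane the an2 spine's
`JsRowD1Pin` ∕ B1_mean consumers meet) is, eventually-equal term by term, the CESÀRO one-shot estimate `hKshotM : (secondMoment (TshotOf Lc Jc m) μ ν − c (Lc^m)) ∕ m → 0` —
a WEAKER demand on the (A1)–(A3) dictionary than `hKshot` (an `o(m)` defect instead of `O(1)`), paid for by the displayed all-scales bound `hall` of row G-an2-4.  After this
file BOTH lanes' ENDs display the telescoping binder BY THE LITERATURE's ∕ SPINE's NAMES, both lanes supply `D1Rep`, and their (K) slots read, composed with `hK`: «the (1.22)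
second moment of the literal one-shot kernel `TshotOf Lc Jc m` is the background-Feynman one-shot expression at side `Lc^m` up to `U₁` (total-shell lane) ∕ up to `o(m)`
(mean lane)».  The `D1Tel` forms of §2∕§3 are ONE substitution away (`hsum := StepDriftWitness.d1Sum_of_d1Tel Js Jc hW hRfl htel μ ν`, as the owner's `d1Rep_BFx_of_D1Tel_shotKS`)
and are not spelled out (400-line budget).

CONTENT.
* §1 [folklore] `hB1mean_of_D1Sum_hKshotMean`, `hKshotMean_of_D1Sum_hB1mean`, **`hB1mean_iff_hKshotMean_of_D1Sum`**, `hB1mean_iff_hKshotMean_of_D1Tel` — the Cesàro forms of the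
  owner's `hB1_iff_hKshot_of_D1Sum` ∕ `hB1_iff_hKshot_of_D1Tel` (eventual equality along `atTop` + `Filter.Tendsto.congr'`).
* §2 [folklore] **`d1Drift_BFx_mean_of_D1Sum_shotKS'`** — THE MEAN-LANE «END-ii» END OVER `D1Sum`: `RoadEndBFxWiredMeanS.d1Drift_BFx_mean_of_prop12S'` with its Cesàro bridge `hB1`
  REPLACED by `(Jc)(hsum : D1Sum Lc Js Jc μ ν)(hKshotM)`; EVERY OTHER BINDER BYTE-IDENTICAL (the owner's §2 substitution applied to the mean lane, same position).
* §3 [folklore] **`d1Rep_BFx_mean_of_D1Sum_shotKS' … (hSL : SL.Nonempty) (k : L → Fin 4) : D1Rep Lc Jc N μ ν a SL k`** — THE MEAN LANE SUPPLIES THE SPINE's `D1Rep` from EXACTLY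
  §2's displayed list + base-point labels (§2 ⟹ `D1Drift`; `StepDriftWitness.d1Rep_iff_d1Drift_of_d1Sum` with the owner's `window_id`; the road's `h12`∕`h126` spelling
  `fam nOf hn1 MOf a ha` IS the Literature's by `abbrev` unfolding — leaf-01 X5 junction J5b).
Unit `b2b-balaban-beta-d1-formalise-leaf-01` (gen 17), D1 formalisation swarm leaf prover 01, road «BF-x»; `LEAVES-BFx.md` rows «END-D1Tel-S»∕«END-D1Sum-S» (mean lane) ∕
«END-WIRED-S ∕ END-ii»; the owner's l.34792 ∕ l.34858 leave the mean-lane B1 side to the lane's author.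
-/

noncomputable section

open Finset Filter Topology
open Literature.Probability.LatticeModels (annulus)
open scoped BigOperators
open Literature.MathematicalPhysics.QuantumFieldTheory
open Literature.MathematicalPhysics.QuantumFieldTheory.Balaban1983to89
open Literature.MathematicalPhysics.QuantumFieldTheory.Balaban1983to89.Beta
open RemainderConstAllScales (AllScalesSeq)
open OneStepResolventKernel (JetData KInv)
open OneStepKernelFamily (TbalOf TshotOf flipK D1Tel D1Rep D1Drift)
open StepDriftWitness (D1Sum d1Sum_iff d1Sum_of_d1Tel d1Rep_iff_d1Drift_of_d1Sum)
open PolarizationSign (WardTransversal AxisReflectionCovariant)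
open InterLevelTransport (onLat)
open BalabanStepJets (lamCoeffOf)
open AveragingHessianKernels (hessFF)
open KernelWard (divV)
open WindowIdentification (fullSum)
open B12Sec2to5 (l1)
open DyadicShell (Pt toReal supNorm)
open ExpKernelCalculus (Site MKer BiLoc shiftK comp)
open GhostTable (gFree)
open BubbleTransfer (unitVec)
open DressedMomentNormalisation (resSite)
open Summit.QuantumFields.BalabanUV.Beta.TameKernelCalculus (Spr Loc trK)
open Summit.QuantumFields.BalabanUV.Beta.D1BFx.ReducedKernel (TableR TOfRed)
open Summit.QuantumFields.BalabanUV.Beta.D1BFx.DressedTadpoleTable (tableRed tadpoleTable)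
open Summit.QuantumFields.BalabanUV.Beta.D1BFx.ReducedKernelSandwich (fineHess)
open Summit.QuantumFields.BalabanUV.Beta.D1BFx.FineStencilBF (ffOf)
open Summit.QuantumFields.BalabanUV.Beta.D1BFx.FineStencilBFBalaban (SbfBal)
open Summit.QuantumFields.BalabanUV.Beta.D1BFx.SecondStencilBF (Wbf)
open Summit.QuantumFields.BalabanUV.Beta.D1BFx.GhostKernelComplete (PghQ fineHessGhQ)
open Summit.QuantumFields.BalabanUV.Beta.D1BFx.GluonLeg (Ga)
open Summit.QuantumFields.BalabanUV.Beta.D1BFx.FrozenLegProfile (gfrz)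
open Summit.QuantumFields.BalabanUV.Beta.D1BFx.RoadEndBFxWiredMeanS (d1Drift_BFx_mean_of_prop12S')
open Summit.QuantumFields.BalabanUV.Beta.D1BFx.RoadEndBFxD1SumS (window_id)
open Summit.QuantumFields.BalabanUV.Beta.D1BFx.FrozenLegTails (nOf MOf hn1)
open VectorTailsLoc (fam kfam)

namespace Summit.QuantumFields.BalabanUV.Beta.D1BFx.RoadEndBFxD1SumMeanS

variable {Lc : ℕ} [NeZero Lc] {a N cgh₀ : ℝ} {μ ν : Fin 4} {υ : Type*} [Fintype υ]
  {cE cVH cΛ cR cK cQ cE₂ cJ4 cΛ₂ cR₂ cQ₂ x₀ ωgl ωgh cgh : ℕ → ℝ} {WE WJ WΛ WR WQ : ℕ → TableR} {CE CJ CΛt CRt CQ δW : ℕ → ℝ}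
  {Ru : υ → ℕ → ℝ} {CU : υ → ℝ} {D₂ κ θ : ℝ}
  {TΛ WA : ℕ → Fin 4 → Site 4 → Fin 4 → Site 4 → MKer 4 (Fin 4)} {CT δT : ℕ → ℝ}
  {ε : ℕ → ℝ} {X : ℕ → Site 4 → MKer 4 (Fin 4)} {Cx δx : ℕ → ℝ}

/-! ## §1 Under `D1Sum` (hence under the spine's `D1Tel` + printed symmetries) bridge B1 in CESÀRO form IS the CESÀRO one-shot (K)-estimate -/

/-- [folklore] **CESÀRO BRIDGE B1 FROM `D1Sum` + THE CESÀRO ONE-SHOT (K)-ESTIMATE.**  Under `StepDriftWitness.D1Sum Lc Js Jc μ ν` the sequences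
`m ↦ ((Σ_{j<m} secondMoment (TbalOf Lc Js j) μ ν) − c (Lc^m)) ∕ m` and `m ↦ (secondMoment (TshotOf Lc Jc m) μ ν − c (Lc^m)) ∕ m` coincide for `m ≥ 1` (`d1Sum_iff`), hence
eventually along `atTop`; so `hKshotM → 0` IS the mean lane's bridge `→ 0` (`Filter.Tendsto.congr'`). -/
theorem hB1mean_of_D1Sum_hKshotMean (Js : ℕ → JetData 3 Lc) (Jc : ∀ m : ℕ, JetData 3 (Lc ^ m)) (c : ℕ → ℝ) (hsum : D1Sum Lc Js Jc μ ν)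
    (hKshotM : Tendsto (fun m : ℕ => (B12Beta.secondMoment (TshotOf Lc Jc m) μ ν - c (Lc ^ m)) / (m : ℝ)) atTop (𝓝 0)) :
    Tendsto (fun m : ℕ => ((∑ j ∈ range m, B12Beta.secondMoment (TbalOf Lc Js j) μ ν) - c (Lc ^ m)) / (m : ℝ)) atTop (𝓝 0) := by
  refine Filter.Tendsto.congr' ?_ hKshotM
  filter_upwards [Filter.eventually_ge_atTop 1] with m hm
  rw [(d1Sum_iff Js Jc μ ν).1 hsum m hm]

/-- [folklore] **… AND CONVERSELY**: under `D1Sum` the mean lane's Cesàro bridge IS the Cesàro one-shot (K)-estimate. -/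
theorem hKshotMean_of_D1Sum_hB1mean (Js : ℕ → JetData 3 Lc) (Jc : ∀ m : ℕ, JetData 3 (Lc ^ m)) (c : ℕ → ℝ) (hsum : D1Sum Lc Js Jc μ ν)
    (hB1 : Tendsto (fun m : ℕ => ((∑ j ∈ range m, B12Beta.secondMoment (TbalOf Lc Js j) μ ν) - c (Lc ^ m)) / (m : ℝ)) atTop (𝓝 0)) :
    Tendsto (fun m : ℕ => (B12Beta.secondMoment (TshotOf Lc Jc m) μ ν - c (Lc ^ m)) / (m : ℝ)) atTop (𝓝 0) := by
  refine Filter.Tendsto.congr' ?_ hB1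
  filter_upwards [Filter.eventually_ge_atTop 1] with m hm
  rw [(d1Sum_iff Js Jc μ ν).1 hsum m hm]

/-- [folklore] **CESÀRO B1 ↔ CESÀRO (K)-SHOT UNDER `D1Sum`** — the mean-lane form of the owner's `RoadEndBFxD1SumS.hB1_iff_hKshot_of_D1Sum`. -/
theorem hB1mean_iff_hKshotMean_of_D1Sum (Js : ℕ → JetData 3 Lc) (Jc : ∀ m : ℕ, JetData 3 (Lc ^ m)) (c : ℕ → ℝ) (hsum : D1Sum Lc Js Jc μ ν) :
    Tendsto (fun m : ℕ => ((∑ j ∈ range m, B12Beta.secondMoment (TbalOf Lc Js j) μ ν) - c (Lc ^ m)) / (m : ℝ)) atTop (𝓝 0) ↔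
      Tendsto (fun m : ℕ => (B12Beta.secondMoment (TshotOf Lc Jc m) μ ν - c (Lc ^ m)) / (m : ℝ)) atTop (𝓝 0) :=
  ⟨hKshotMean_of_D1Sum_hB1mean Js Jc c hsum, hB1mean_of_D1Sum_hKshotMean Js Jc c hsum⟩

/-- [folklore] **CESÀRO B1 ↔ CESÀRO (K)-SHOT UNDER THE SPINE's `D1Tel` + THE PRINTED SYMMETRIES** (the binder texts `hW`∕`hRfl`∕`htel` of
`OneStepKernelFamily.d1Drift_of_D1Tel_D1Rep`, via `StepDriftWitness.d1Sum_of_d1Tel`) — the mean-lane form of the owner's `RoadEndBFxD1TelS.hB1_iff_hKshot_of_D1Tel`. -/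
theorem hB1mean_iff_hKshotMean_of_D1Tel (Js : ℕ → JetData 3 Lc) (Jc : ∀ m : ℕ, JetData 3 (Lc ^ m)) (c : ℕ → ℝ)
    (hW : ∀ j, WardTransversal (flipK (TbalOf Lc Js j))) (hRfl : ∀ j, AxisReflectionCovariant (flipK (TbalOf Lc Js j)))
    (htel : D1Tel Lc Js Jc) :
    Tendsto (fun m : ℕ => ((∑ j ∈ range m, B12Beta.secondMoment (TbalOf Lc Js j) μ ν) - c (Lc ^ m)) / (m : ℝ)) atTop (𝓝 0) ↔
      Tendsto (fun m : ℕ => (B12Beta.secondMoment (TshotOf Lc Jc m) μ ν - c (Lc ^ m)) / (m : ℝ)) atTop (𝓝 0) :=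
  hB1mean_iff_hKshotMean_of_D1Sum Js Jc c (d1Sum_of_d1Tel Js Jc hW hRfl htel μ ν)

/-! ## §2 THE MEAN-LANE «END-ii» END OVER `D1Sum` AND THE CESÀRO ONE-SHOT (K)-ESTIMATE -/

/-- [folklore] **ROAD BF-x, THE MEAN-LANE «END-ii» END OVER THE READ-OUT-LEVEL TELESCOPING BINDER.**  `RoadEndBFxWiredMeanS.d1Drift_BFx_mean_of_prop12S'` (p298064) with its
Cesàro bridge `hB1` REPLACED by: composite jet data `Jc`, `hsum : D1Sum Lc Js Jc μ ν` (the Literature's weakest telescoping binder; ⟸ the spine's `D1Tel` + `hW`∕`hRfl` by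
`d1Sum_of_d1Tel`), and the CESÀRO ONE-SHOT (K)-ESTIMATE `hKshotM : (secondMoment (TshotOf Lc Jc m) μ ν − c (Lc^m)) ∕ m → 0` (§1); the all-scales bound `hall`∕`hθ0`∕`hθ1`
(row G-an2-4) stays displayed.  Every other binder BYTE-IDENTICAL to p298064 §3 (hence to the owner's `RoadEndBFxD1SumS.d1Drift_BFx_of_D1Sum_shotKS` but for {`hall`, `hθ0`, `hθ1`,
`hKshotM`} ↔ {`hKshot`}): (K) `hK`; `hωs`+`hs`+`hlam`; pins; ray + P13; the five slot-table sockets + covariance + bond swap; `hdiv`; shell rows `h2s`∕`d2s`; slot E∕R∕Q sockets;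
(Λ) sockets + `cΛ ≠ 0`, `ε = ±1`, `hX`, (W1), (W2′); (U); `h12`∕`h126` BY NAME.  ⇒ `D1Drift Lc Js N μ ν` for ANY `Js`, `μ ≠ ν`, `N ≠ 0`, odd `Lc ≥ 2`.  HONEST: composition BY NAME
(§1 + p298064 §3); `D1Sum`, `hKshotM`, `hall`, `hK` and every socket∕pin are HYPOTHESES; 0 root-level binders discharged (hW ∕ hR-sockets ∕ hSX-socket ∕ D1Tel ∕ D1Rep — 0);
(K) NOT closed; NOT D1, NOT `BetaPertH`, NOT continuum, NOT Clay. -/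
theorem d1Drift_BFx_mean_of_D1Sum_shotKS' (Js : ℕ → JetData 3 Lc) (hμν : μ ≠ ν) (hN : N ≠ 0) (hL : 2 ≤ Lc) (hodd : Odd Lc)
    (ha : 0 < a) (c : ℕ → ℝ) {A₂ δ₂ : ℝ} (hD₂ : 0 ≤ D₂) (hA₂ : 0 ≤ A₂) (hδ₂ : 0 < δ₂)
    (h12 : B5.Prop12Printed (fam nOf hn1 MOf a ha)) (h126 : B5.Kernel126_127Printed (kfam nOf MOf))
    (h2s : ∀ n : ℕ, 2 ≤ n → ∀ [NeZero n], ∀ b ∈ (univ : Finset (Fin 4 → Fin n)).image resSite, ∀ r : ℕ, r + 1 ≤ n →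
      ∑ v ∈ annulus 4 r (r + 1), |(gfrz n a b (v + unitVec ν + unitVec μ) - gFree (v + unitVec ν + unitVec μ)) -
          (gfrz n a b (v + unitVec ν) - gFree (v + unitVec ν)) - (gfrz n a b (v + unitVec μ) - gFree (v + unitVec μ)) +
          (gfrz n a b v - gFree v)| ≤ D₂ / (n : ℝ))
    (d2s : ∀ n : ℕ, 2 ≤ n → ∀ [NeZero n], ∀ b ∈ (univ : Finset (Fin 4 → Fin n)).image resSite, ∀ r : ℕ, n ≤ r →
      ∑ v ∈ annulus 4 r (r + 1), |gfrz n a b (v + unitVec ν + unitVec μ) - gfrz n a b (v + unitVec ν) - gfrz n a b (v + unitVec μ) + gfrz n a b v| ≤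
        A₂ * Real.exp (-(δ₂ / n) * ((r : ℝ) + 1)) / ((r : ℝ) + 1))
    -- MEAN grading: the displayed all-scales bound on the step coefficients (row G-an2-4) …
    (hall : AllScalesSeq (fun j => B12Beta.secondMoment (TbalOf Lc Js j) μ ν) κ θ) (hθ0 : 0 ≤ θ) (hθ1 : θ < 1)
    -- … and, for bridge B1 in CESÀRO form: the spine's composite jet data, the Literature's read-out-level telescoping binder, and the CESÀRO one-shot (K)-estimate
    (Jc : ∀ m : ℕ, JetData 3 (Lc ^ m)) (hsum : D1Sum Lc Js Jc μ ν)
    (hKshotM : Tendsto (fun m : ℕ => (B12Beta.secondMoment (TshotOf Lc Jc m) μ ν - c (Lc ^ m)) / (m : ℝ)) atTop (𝓝 0))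
    (hK : ∀ n : ℕ, 2 ≤ n → Odd n → ∀ [NeZero n], c n =
      ωgl n * B12Beta.secondMoment (TOfRed n a (SbfBal n a (cE n) (cVH n) (cΛ n) (cR n) (cK n) (cQ n))
        (tableRed n (Wbf (cE₂ n) (cJ4 n) (cΛ₂ n) (cR₂ n) (cQ₂ n) (WE n) (WJ n) (WΛ n) (WR n) (WQ n)))) μ ν
      + ωgh n * B12Beta.secondMoment (PghQ n a (x₀ n) (cK n) (cQ n)) μ ν + ∑ u, Ru u n)
    -- the RESCALED loop-weight tie of reading (ii): displayed scalar family `s`, pinned `s n = n⁻²`; the normalisation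
    (s : ℕ → ℝ) (hs : ∀ n : ℕ, 2 ≤ n → s n = ((n : ℝ) ^ 2)⁻¹) (hωs : ∀ n : ℕ, 2 ≤ n → ωgh n * (s n * cK n) ^ 2 = -2 * (ωgl n * cE n ^ 2))
    (hlam : ∀ n : ℕ, 2 ≤ n → ωgl n * cE n ^ 2 = 2 * N ^ 2 * (n : ℝ) ^ 8)
    -- pins and the ray (the rows' letters)
    (hcE : ∀ n : ℕ, 2 ≤ n → cE n = (n : ℝ) ^ 4) (hRsgn : ∀ n : ℕ, 2 ≤ n → cR n = -cE n) (hJ4 : ∀ n : ℕ, cJ4 n = 0)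
    (hcgh : ∀ n : ℕ, |cgh n| ≤ cgh₀) (hKray : ∀ n : ℕ, cK n = cgh n * (n : ℝ) ^ 2) (hQray : ∀ n : ℕ, cQ n = cgh n * a) (hx : ∀ n : ℕ, x₀ n = -cgh n)
    -- slot-table sockets (the END's), covariance, bond swap; `hdiv` (the ghost Ward rows `hrowgh` are a THEOREM on the ray: discharged inside)
    (hδW : ∀ n, 0 < δW n)
    (hE : ∀ n κ u l u', BiLoc (WE n κ u l u') u u' (CE n) (δW n)) (hJ : ∀ n κ u l u', BiLoc (WJ n κ u l u') u u' (CJ n) (δW n))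
    (hΛ : ∀ n κ u l u', BiLoc (WΛ n κ u l u') u u' (CΛt n) (δW n)) (hR : ∀ n κ u l u', BiLoc (WR n κ u l u') u u' (CRt n) (δW n))
    (hQ : ∀ n κ u l u', BiLoc (WQ n κ u l u') u u' (CQ n) (δW n))
    (hEc : ∀ (n : ℕ) (κ : Fin 4) (u : Site 4) (l : Fin 4) (u' t : Site 4),
      WE n κ (u + (n : ℤ) • t) l (u' + (n : ℤ) • t) = shiftK (-((n : ℤ) • t)) (WE n κ u l u'))
    (hJc : ∀ (n : ℕ) (κ : Fin 4) (u : Site 4) (l : Fin 4) (u' t : Site 4),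
      WJ n κ (u + (n : ℤ) • t) l (u' + (n : ℤ) • t) = shiftK (-((n : ℤ) • t)) (WJ n κ u l u'))
    (hΛc : ∀ (n : ℕ) (κ : Fin 4) (u : Site 4) (l : Fin 4) (u' t : Site 4),
      WΛ n κ (u + (n : ℤ) • t) l (u' + (n : ℤ) • t) = shiftK (-((n : ℤ) • t)) (WΛ n κ u l u'))
    (hRc : ∀ (n : ℕ) (κ : Fin 4) (u : Site 4) (l : Fin 4) (u' t : Site 4),
      WR n κ (u + (n : ℤ) • t) l (u' + (n : ℤ) • t) = shiftK (-((n : ℤ) • t)) (WR n κ u l u'))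
    (hQc : ∀ (n : ℕ) (κ : Fin 4) (u : Site 4) (l : Fin 4) (u' t : Site 4),
      WQ n κ (u + (n : ℤ) • t) l (u' + (n : ℤ) • t) = shiftK (-((n : ℤ) • t)) (WQ n κ u l u'))
    (hEs : ∀ n κ u l u', WE n κ u l u' = WE n l u' κ u) (hJs : ∀ n κ u l u', WJ n κ u l u' = WJ n l u' κ u)
    (hΛs : ∀ n κ u l u', WΛ n κ u l u' = WΛ n l u' κ u) (hRs : ∀ n κ u l u', WR n κ u l u' = WR n l u' κ u)
    (hQs : ∀ n κ u l u', WQ n κ u l u' = WQ n l u' κ u)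
    (hdiv : ∀ n : ℕ, 2 ≤ n → ∀ [NeZero n], ∀ (l' : Fin 4) (u' u : Site 4), ∑ κ' : Fin 4,
      (fineHess n a (SbfBal n a (cE n) (cVH n) (cΛ n) (cR n) (cK n) (cQ n))
          (Wbf (cE₂ n) (cJ4 n) (cΛ₂ n) (cR₂ n) (cQ₂ n) (WE n) (WJ n) (WΛ n) (WR n) (WQ n)) κ' l' (u - Pi.single κ' 1) u'
        - fineHess n a (SbfBal n a (cE n) (cVH n) (cΛ n) (cR n) (cK n) (cQ n))
          (Wbf (cE₂ n) (cJ4 n) (cΛ₂ n) (cR₂ n) (cQ₂ n) (WE n) (WJ n) (WΛ n) (WR n) (WQ n)) κ' l' u u') = 0)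
    -- (LOCAL) slot-E support and units; slot-R envelope and units (the three local ghost bubbles are SUPPLIED under reading (ii))
    {ρE : ℕ} {δ₀ kE : ℝ} (hδ₀ : 0 < δ₀) (hδE : ∀ n, δ₀ ≤ δW n)
    (hsuppE : ∀ n κ u l u', ρE < supNorm (u - u') → WE n κ u l u' = 0)
    (hkE : ∀ n : ℕ, 2 ≤ n → |ωgl n * cE₂ n| * CE n ≤ kE * (n : ℝ) ^ 8)
    {CwR δR : ℕ → ℝ} {θR δ₀R kR : ℝ} (hθR : 0 < θR) (hδR : ∀ n, 0 < δR n) (hδ₀R : 0 < δ₀R) (hδRge : ∀ n : ℕ, δ₀R / n ≤ δR n) (hCwR : ∀ n, 0 ≤ CwR n)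
    (hWRenv : ∀ n κ u l u', BiLoc (WR n κ u l u') u u' (CwR n * Real.exp (-(θR / n) * supNorm (u - u'))) (δR n))
    (hkR : ∀ n : ℕ, 2 ≤ n → |ωgl n * cR₂ n| * CwR n * (n : ℝ) ^ 6 ≤ kR)
    -- (Λ) sockets and zero-momentum data
    (hδT : ∀ n, 0 < δT n)
    (hdec : ∀ n : ℕ, 2 ≤ n → ∀ [NeZero n], ∀ κ u l u', WΛ n κ u l u' =
      (∑ m : Fin 4, OneStepResolventKernel.wsum (onLat n (fun y => lamCoeffOf (KInv (N := n) (d := 3)) n m y l u'))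
          (fun v => onLat n (fun y => TΛ n m y κ u) v))
      + (∑ m : Fin 4, OneStepResolventKernel.wsum (onLat n (fun y => lamCoeffOf (KInv (N := n) (d := 3)) n m y κ u))
          (fun v => onLat n (fun y => TΛ n m y l u') v))
      + WA n κ u l u')
    (hTloc : ∀ (n : ℕ) m y κ u, BiLoc (TΛ n m y κ u) ((n : ℤ) • y) ((n : ℤ) • y) (CT n * Real.exp (-δT n * l1 ((n : ℤ) • y - u))) (δT n))
    (hWAa : ∀ n κ u l u', trK (WA n κ u l u') = -WA n κ u l u') (hWAl : ∀ n κ u l u', Loc (WA n κ u l u'))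
    (hTcov : ∀ (n : ℕ) m y κ u t, TΛ n m (y + t) κ (u + (n : ℤ) • t) = shiftK (-((n : ℤ) • t)) (TΛ n m y κ u))
    (hcΛ : ∀ n : ℕ, 2 ≤ n → cΛ n ≠ 0) (hε : ∀ n : ℕ, ε n = 1 ∨ ε n = -1) (hδx : ∀ n, 0 < δx n) (hX : ∀ n u, BiLoc (X n u) u u (Cx n) (δx n))
    (hW1 : ∀ n : ℕ, 2 ≤ n → ∀ [NeZero n], ∀ u,
      comp (comp (Ga n a) (divV (fun κ v => ε n • SbfBal n a (cE n) (cVH n) (cΛ n) (cR n) (cK n) (cQ n) κ v) u)) (Ga n a) =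
        comp (Ga n a) (X n u) - comp (X n u) (Ga n a))
    (hW2 : ∀ n : ℕ, 2 ≤ n → ∀ [NeZero n], ∀ (m : Fin 4) (u : Site 4),
      divV (fun κ v => (-(ε n * (cΛ₂ n / cΛ n))) • TΛ n m 0 κ v) u = comp (X n u) (ffOf (hessFF n m 0)) - comp (ffOf (hessFF n m 0)) (X n u))
    -- (N) slot Q's SOCKETS (the (A2) readout of `WQ`: a decaying bi-localisation envelope at a BLOCK-scale rate floor and its units line — T₈ ⟸ `NeedleTadpoleRowDecay`)
    {CwQ δQ : ℕ → ℝ} {θQ δ₀Q kQ : ℝ} (hθQ : 0 < θQ) (hδQ : ∀ n, 0 < δQ n) (hδ₀Q : 0 < δ₀Q) (hδQge : ∀ n : ℕ, δ₀Q / n ≤ δQ n) (hCwQ : ∀ n, 0 ≤ CwQ n)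
    (hWQenv : ∀ n κ u l u', BiLoc (WQ n κ u l u') u u' (CwQ n * Real.exp (-(θQ / n) * supNorm (u - u'))) (δQ n))
    (hkQ : ∀ n : ℕ, 2 ≤ n → |ωgl n * cQ₂ n| * CwQ n * (n : ℝ) ^ 6 ≤ kQ)
    -- (U)
    (hU : ∀ n : ℕ, 2 ≤ n → ∀ u, |Ru u n| ≤ CU u) :
    D1Drift Lc Js N μ ν :=
  d1Drift_BFx_mean_of_prop12S' Js hμν hN hL hodd ha c hD₂ hA₂ hδ₂ h12 h126 h2s d2s hall hθ0 hθ1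
    (hB1mean_of_D1Sum_hKshotMean Js Jc c hsum hKshotM) hK s hs hωs hlam hcE hRsgn hJ4 hcgh hKray hQray hx hδW hE hJ hΛ hR hQ hEc hJc hΛc hRc
    hQc hEs hJs hΛs hRs hQs hdiv hδ₀ hδE hsuppE hkE hθR hδR hδ₀R hδRge hCwR hWRenv hkR hδT hdec hTloc hWAa hWAl hTcov hcΛ hε hδx hX hW1 hW2 hθQ hδQ hδ₀Q
    hδQge hCwQ hWQenv hkQ hU

/-! ## §3 THE MEAN LANE SUPPLIES THE SPINE's `D1Rep` -/

/-- [folklore] **ROAD BF-x, MEAN LANE ⟹ THE SPINE's `D1Rep`.**  From EXACTLY the displayed list of §2 (`hall`∕`hθ0`∕`hθ1`, `Jc`, `hsum : D1Sum Lc Js Jc μ ν`, `hKshotM`, (K) `hK`,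
`hωs`+`hs`+`hlam`, pins, ray + P13, the five slot-table sockets + covariance + bond swap, `hdiv`, `h2s`∕`d2s`, slot E∕R∕Q sockets, (Λ) sockets + (W1)(W2′), (U), `h12`∕`h126` BY
NAME) plus base-point labels `hSL : SL.Nonempty`, `k : L → Fin 4`: the spine root's representation binder `D1Rep Lc Jc N μ ν a SL k`.  Proof: §2 gives `D1Drift Lc Js N μ ν`; the
Literature's `D1Rep ⟺ D1Drift` GIVEN `D1Sum` (`StepDriftWitness.d1Rep_iff_d1Drift_of_d1Sum` — the free-bubble drift under `h12`∕`h126`), window data by the owner's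
`RoadEndBFxD1SumS.window_id`; the road's `h12 : B5.Prop12Printed (fam nOf hn1 MOf a ha)` IS the Literature's `fam (fun i => ((i.1 : ℕ+) : ℕ)) (fun i => i.1.pos) MvE a ha` by
`abbrev` unfolding (leaf-01 X5 junction J5b), accepted by the kernel as is.  The mean-lane form of the owner's `d1Rep_BFx_of_D1Sum_shotKS`: the uniform `hKshot` traded for the
CESÀRO `hKshotM` + the all-scales bound `hall`.  HONEST: composition BY NAME; `hKshotM`, `hall`, `hK`, every socket∕pin∕row are HYPOTHESES (none proved for Bałaban's jets; `Jc`
not constructed); 0 root-level binders discharged; (K) NOT closed; NOT D1, NOT `BetaPertH`, NOT continuum, NOT Clay. -/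
theorem d1Rep_BFx_mean_of_D1Sum_shotKS' (Js : ℕ → JetData 3 Lc) (hμν : μ ≠ ν) (hN : N ≠ 0) (hL : 2 ≤ Lc) (hodd : Odd Lc)
    (ha : 0 < a) (c : ℕ → ℝ) {A₂ δ₂ : ℝ} (hD₂ : 0 ≤ D₂) (hA₂ : 0 ≤ A₂) (hδ₂ : 0 < δ₂)
    (h12 : B5.Prop12Printed (fam nOf hn1 MOf a ha)) (h126 : B5.Kernel126_127Printed (kfam nOf MOf))
    (h2s : ∀ n : ℕ, 2 ≤ n → ∀ [NeZero n], ∀ b ∈ (univ : Finset (Fin 4 → Fin n)).image resSite, ∀ r : ℕ, r + 1 ≤ n →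
      ∑ v ∈ annulus 4 r (r + 1), |(gfrz n a b (v + unitVec ν + unitVec μ) - gFree (v + unitVec ν + unitVec μ)) -
          (gfrz n a b (v + unitVec ν) - gFree (v + unitVec ν)) - (gfrz n a b (v + unitVec μ) - gFree (v + unitVec μ)) +
          (gfrz n a b v - gFree v)| ≤ D₂ / (n : ℝ))
    (d2s : ∀ n : ℕ, 2 ≤ n → ∀ [NeZero n], ∀ b ∈ (univ : Finset (Fin 4 → Fin n)).image resSite, ∀ r : ℕ, n ≤ r →
      ∑ v ∈ annulus 4 r (r + 1), |gfrz n a b (v + unitVec ν + unitVec μ) - gfrz n a b (v + unitVec ν) - gfrz n a b (v + unitVec μ) + gfrz n a b v| ≤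
        A₂ * Real.exp (-(δ₂ / n) * ((r : ℝ) + 1)) / ((r : ℝ) + 1))
    -- MEAN grading: the displayed all-scales bound on the step coefficients (row G-an2-4) …
    (hall : AllScalesSeq (fun j => B12Beta.secondMoment (TbalOf Lc Js j) μ ν) κ θ) (hθ0 : 0 ≤ θ) (hθ1 : θ < 1)
    -- … and, for bridge B1 in CESÀRO form: the spine's composite jet data, the Literature's read-out-level telescoping binder, and the CESÀRO one-shot (K)-estimate
    (Jc : ∀ m : ℕ, JetData 3 (Lc ^ m)) (hsum : D1Sum Lc Js Jc μ ν)
    (hKshotM : Tendsto (fun m : ℕ => (B12Beta.secondMoment (TshotOf Lc Jc m) μ ν - c (Lc ^ m)) / (m : ℝ)) atTop (𝓝 0))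
    (hK : ∀ n : ℕ, 2 ≤ n → Odd n → ∀ [NeZero n], c n =
      ωgl n * B12Beta.secondMoment (TOfRed n a (SbfBal n a (cE n) (cVH n) (cΛ n) (cR n) (cK n) (cQ n))
        (tableRed n (Wbf (cE₂ n) (cJ4 n) (cΛ₂ n) (cR₂ n) (cQ₂ n) (WE n) (WJ n) (WΛ n) (WR n) (WQ n)))) μ ν
      + ωgh n * B12Beta.secondMoment (PghQ n a (x₀ n) (cK n) (cQ n)) μ ν + ∑ u, Ru u n)
    -- the RESCALED loop-weight tie of reading (ii): displayed scalar family `s`, pinned `s n = n⁻²`; the normalisation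
    (s : ℕ → ℝ) (hs : ∀ n : ℕ, 2 ≤ n → s n = ((n : ℝ) ^ 2)⁻¹) (hωs : ∀ n : ℕ, 2 ≤ n → ωgh n * (s n * cK n) ^ 2 = -2 * (ωgl n * cE n ^ 2))
    (hlam : ∀ n : ℕ, 2 ≤ n → ωgl n * cE n ^ 2 = 2 * N ^ 2 * (n : ℝ) ^ 8)
    -- pins and the ray (the rows' letters)
    (hcE : ∀ n : ℕ, 2 ≤ n → cE n = (n : ℝ) ^ 4) (hRsgn : ∀ n : ℕ, 2 ≤ n → cR n = -cE n) (hJ4 : ∀ n : ℕ, cJ4 n = 0)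
    (hcgh : ∀ n : ℕ, |cgh n| ≤ cgh₀) (hKray : ∀ n : ℕ, cK n = cgh n * (n : ℝ) ^ 2) (hQray : ∀ n : ℕ, cQ n = cgh n * a) (hx : ∀ n : ℕ, x₀ n = -cgh n)
    -- slot-table sockets (the END's), covariance, bond swap; `hdiv` (the ghost Ward rows `hrowgh` are a THEOREM on the ray: discharged inside)
    (hδW : ∀ n, 0 < δW n)
    (hE : ∀ n κ u l u', BiLoc (WE n κ u l u') u u' (CE n) (δW n)) (hJ : ∀ n κ u l u', BiLoc (WJ n κ u l u') u u' (CJ n) (δW n))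
    (hΛ : ∀ n κ u l u', BiLoc (WΛ n κ u l u') u u' (CΛt n) (δW n)) (hR : ∀ n κ u l u', BiLoc (WR n κ u l u') u u' (CRt n) (δW n))
    (hQ : ∀ n κ u l u', BiLoc (WQ n κ u l u') u u' (CQ n) (δW n))
    (hEc : ∀ (n : ℕ) (κ : Fin 4) (u : Site 4) (l : Fin 4) (u' t : Site 4),
      WE n κ (u + (n : ℤ) • t) l (u' + (n : ℤ) • t) = shiftK (-((n : ℤ) • t)) (WE n κ u l u'))
    (hJc : ∀ (n : ℕ) (κ : Fin 4) (u : Site 4) (l : Fin 4) (u' t : Site 4),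
      WJ n κ (u + (n : ℤ) • t) l (u' + (n : ℤ) • t) = shiftK (-((n : ℤ) • t)) (WJ n κ u l u'))
    (hΛc : ∀ (n : ℕ) (κ : Fin 4) (u : Site 4) (l : Fin 4) (u' t : Site 4),
      WΛ n κ (u + (n : ℤ) • t) l (u' + (n : ℤ) • t) = shiftK (-((n : ℤ) • t)) (WΛ n κ u l u'))
    (hRc : ∀ (n : ℕ) (κ : Fin 4) (u : Site 4) (l : Fin 4) (u' t : Site 4),
      WR n κ (u + (n : ℤ) • t) l (u' + (n : ℤ) • t) = shiftK (-((n : ℤ) • t)) (WR n κ u l u'))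
    (hQc : ∀ (n : ℕ) (κ : Fin 4) (u : Site 4) (l : Fin 4) (u' t : Site 4),
      WQ n κ (u + (n : ℤ) • t) l (u' + (n : ℤ) • t) = shiftK (-((n : ℤ) • t)) (WQ n κ u l u'))
    (hEs : ∀ n κ u l u', WE n κ u l u' = WE n l u' κ u) (hJs : ∀ n κ u l u', WJ n κ u l u' = WJ n l u' κ u)
    (hΛs : ∀ n κ u l u', WΛ n κ u l u' = WΛ n l u' κ u) (hRs : ∀ n κ u l u', WR n κ u l u' = WR n l u' κ u)
    (hQs : ∀ n κ u l u', WQ n κ u l u' = WQ n l u' κ u)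
    (hdiv : ∀ n : ℕ, 2 ≤ n → ∀ [NeZero n], ∀ (l' : Fin 4) (u' u : Site 4), ∑ κ' : Fin 4,
      (fineHess n a (SbfBal n a (cE n) (cVH n) (cΛ n) (cR n) (cK n) (cQ n))
          (Wbf (cE₂ n) (cJ4 n) (cΛ₂ n) (cR₂ n) (cQ₂ n) (WE n) (WJ n) (WΛ n) (WR n) (WQ n)) κ' l' (u - Pi.single κ' 1) u'
        - fineHess n a (SbfBal n a (cE n) (cVH n) (cΛ n) (cR n) (cK n) (cQ n))
          (Wbf (cE₂ n) (cJ4 n) (cΛ₂ n) (cR₂ n) (cQ₂ n) (WE n) (WJ n) (WΛ n) (WR n) (WQ n)) κ' l' u u') = 0)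
    -- (LOCAL) slot-E support and units; slot-R envelope and units (the three local ghost bubbles are SUPPLIED under reading (ii))
    {ρE : ℕ} {δ₀ kE : ℝ} (hδ₀ : 0 < δ₀) (hδE : ∀ n, δ₀ ≤ δW n)
    (hsuppE : ∀ n κ u l u', ρE < supNorm (u - u') → WE n κ u l u' = 0)
    (hkE : ∀ n : ℕ, 2 ≤ n → |ωgl n * cE₂ n| * CE n ≤ kE * (n : ℝ) ^ 8)
    {CwR δR : ℕ → ℝ} {θR δ₀R kR : ℝ} (hθR : 0 < θR) (hδR : ∀ n, 0 < δR n) (hδ₀R : 0 < δ₀R) (hδRge : ∀ n : ℕ, δ₀R / n ≤ δR n) (hCwR : ∀ n, 0 ≤ CwR n)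
    (hWRenv : ∀ n κ u l u', BiLoc (WR n κ u l u') u u' (CwR n * Real.exp (-(θR / n) * supNorm (u - u'))) (δR n))
    (hkR : ∀ n : ℕ, 2 ≤ n → |ωgl n * cR₂ n| * CwR n * (n : ℝ) ^ 6 ≤ kR)
    -- (Λ) sockets and zero-momentum data
    (hδT : ∀ n, 0 < δT n)
    (hdec : ∀ n : ℕ, 2 ≤ n → ∀ [NeZero n], ∀ κ u l u', WΛ n κ u l u' =
      (∑ m : Fin 4, OneStepResolventKernel.wsum (onLat n (fun y => lamCoeffOf (KInv (N := n) (d := 3)) n m y l u'))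
          (fun v => onLat n (fun y => TΛ n m y κ u) v))
      + (∑ m : Fin 4, OneStepResolventKernel.wsum (onLat n (fun y => lamCoeffOf (KInv (N := n) (d := 3)) n m y κ u))
          (fun v => onLat n (fun y => TΛ n m y l u') v))
      + WA n κ u l u')
    (hTloc : ∀ (n : ℕ) m y κ u, BiLoc (TΛ n m y κ u) ((n : ℤ) • y) ((n : ℤ) • y) (CT n * Real.exp (-δT n * l1 ((n : ℤ) • y - u))) (δT n))
    (hWAa : ∀ n κ u l u', trK (WA n κ u l u') = -WA n κ u l u') (hWAl : ∀ n κ u l u', Loc (WA n κ u l u'))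
    (hTcov : ∀ (n : ℕ) m y κ u t, TΛ n m (y + t) κ (u + (n : ℤ) • t) = shiftK (-((n : ℤ) • t)) (TΛ n m y κ u))
    (hcΛ : ∀ n : ℕ, 2 ≤ n → cΛ n ≠ 0) (hε : ∀ n : ℕ, ε n = 1 ∨ ε n = -1) (hδx : ∀ n, 0 < δx n) (hX : ∀ n u, BiLoc (X n u) u u (Cx n) (δx n))
    (hW1 : ∀ n : ℕ, 2 ≤ n → ∀ [NeZero n], ∀ u,
      comp (comp (Ga n a) (divV (fun κ v => ε n • SbfBal n a (cE n) (cVH n) (cΛ n) (cR n) (cK n) (cQ n) κ v) u)) (Ga n a) =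
        comp (Ga n a) (X n u) - comp (X n u) (Ga n a))
    (hW2 : ∀ n : ℕ, 2 ≤ n → ∀ [NeZero n], ∀ (m : Fin 4) (u : Site 4),
      divV (fun κ v => (-(ε n * (cΛ₂ n / cΛ n))) • TΛ n m 0 κ v) u = comp (X n u) (ffOf (hessFF n m 0)) - comp (ffOf (hessFF n m 0)) (X n u))
    -- (N) slot Q's SOCKETS (the (A2) readout of `WQ`: a decaying bi-localisation envelope at a BLOCK-scale rate floor and its units line — T₈ ⟸ `NeedleTadpoleRowDecay`)
    {CwQ δQ : ℕ → ℝ} {θQ δ₀Q kQ : ℝ} (hθQ : 0 < θQ) (hδQ : ∀ n, 0 < δQ n) (hδ₀Q : 0 < δ₀Q) (hδQge : ∀ n : ℕ, δ₀Q / n ≤ δQ n) (hCwQ : ∀ n, 0 ≤ CwQ n)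
    (hWQenv : ∀ n κ u l u', BiLoc (WQ n κ u l u') u u' (CwQ n * Real.exp (-(θQ / n) * supNorm (u - u'))) (δQ n))
    (hkQ : ∀ n : ℕ, 2 ≤ n → |ωgl n * cQ₂ n| * CwQ n * (n : ℝ) ^ 6 ≤ kQ)
    -- (U)
    (hU : ∀ n : ℕ, 2 ≤ n → ∀ u, |Ru u n| ≤ CU u)
    -- base-point labels of the free one-shot side (the spine root's `hSL` ∕ `k`); the Literature's window data is discharged at `M := id`, `cc := 1` (the owner's `window_id`)
    {L : Type*} {SL : Finset L} (hSL : SL.Nonempty) (k : L → Fin 4) :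
    D1Rep Lc Jc N μ ν a SL k :=
  (d1Rep_iff_d1Drift_of_d1Sum a ha h12 h126 hSL k hμν hN hL Js Jc hsum window_id.1 window_id.2.1 window_id.2.2).2
    (d1Drift_BFx_mean_of_D1Sum_shotKS' Js hμν hN hL hodd ha c hD₂ hA₂ hδ₂ h12 h126 h2s d2s hall hθ0 hθ1 Jc hsum hKshotM hK s hs hωs hlam hcE hRsgn hJ4 hcgh hKray hQray hx hδW hE hJ hΛ hR hQ hEc hJc hΛc hRc
    hQc hEs hJs hΛs hRs hQs hdiv hδ₀ hδE hsuppE hkE hθR hδR hδ₀R hδRge hCwR hWRenv hkR hδT hdec hTloc hWAa hWAl hTcov hcΛ hε hδx hX hW1 hW2 hθQ hδQ hδ₀Q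
    hδQge hCwQ hWQenv hkQ hU)

end Summit.QuantumFields.BalabanUV.Beta.D1BFx.RoadEndBFxD1SumMeanS

end
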